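import Mathlib
import HarnessLib
import Summits.ResolutionOfSingularities.ResolutionOfSingularities.Theorems.HomologicalConductorPersistenceSurfaceSaturationEdimPresentation

/-!
# Rung S-2 `PersistenceSurface` — the Sat₄ residual, THIRD CUT: «embedding dimension ≥ 4»

Route `ResolutionOfSingularities/HomologicalConductor`, chain W4.4b, rung S-2 `PersistenceSurface`
(stmt-ResolutionOfSingularities-19970); o9/o11 lineage, edim form of the residual (res-L1-w44b-plan-1
ORDER o9g/o9h 2026-08-27T08:21Z «so the residual reads edim T_m ≥ 4»).  [OURS · L1 w44b · res-type-011;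
AI-written, weaker than expert review; NOT a statement of the manuscript under study, and no statement of
that manuscript is used.]

* `IsEdimHypersurfaceCandidate d T` — the CHECKABLE form of «abstract hypersurface stage»: `T` is a local
  domain of Krull dimension `d` and embedding dimension `≤ d + 1` which is a quotient of some regular local
  ring (every local ring essentially of finite type over a field is such a quotient);
* `isRegularHypersurfaceQuotient_of_candidate` — o9h: a candidate that is NOT regular is an abstract
  hypersurface `IsRegularHypersurfaceQuotient d T` (edim `= d + 1` exactly, since edim `= d` means regular);
* `@[conjecture] SaturationFourSurfaceResidual₃` — o3's binders VERBATIM; conclusion only at stages that are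
  not regular, not monic-presented, and NOT edim-candidates (`d = 2`: «quotient of a regular local ring,
  domain, dim 2, edim ≤ 3» fails) — i.e. for presented normal surface stages: EMBEDDING DIMENSION `≥ 4`;
* `saturationFourSurfaceResidual₂_of_residual₃ : SaturationFourSurfaceResidual₃ → SaturationFourSurfaceResidual₂`,
  hence `saturationFourSurface_of_residual₃`, `persistenceSurface_of_residual₃_of_levelFour`.
-/

noncomputable section

-- single-problem summit: the doubled namespace component `ResolutionOfSingularities` is forced
set_option linter.dupNamespace false

namespace Summit.ResolutionOfSingularities.ResolutionOfSingularities.Theorems.HomologicalConductor.PersistenceSurfaceSaturationResidualThree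

open IsLocalRing
open Summit.ResolutionOfSingularities.ResolutionOfSingularities.Theorems.NoZeno.Birth
open Summit.ResolutionOfSingularities.ResolutionOfSingularities.Theorems.HomologicalConductor.PersistenceSurfaceLevelFour
open Summit.ResolutionOfSingularities.ResolutionOfSingularities.Theorems.HomologicalConductor.PersistenceSurfaceSaturationResidual
open Summit.ResolutionOfSingularities.ResolutionOfSingularities.Theorems.HomologicalConductor.PersistenceSurfaceSaturationResidualTwo
open Summit.ResolutionOfSingularities.ResolutionOfSingularities.Theorems.HomologicalConductor.PersistenceSurfaceSaturationEdimPresentation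

/-- **`IsEdimHypersurfaceCandidate d T`** [this work]: `T` is a local DOMAIN of Krull dimension `d`
with embedding dimension `spanFinrank 𝔪_T ≤ d + 1`, presented as a quotient of some regular local ring
`S` (`π : S ↠ T`). The instances are carried existentially so that the predicate applies to a bare
`CommRing`. NOT a statement of the manuscript. -/
def IsEdimHypersurfaceCandidate (d : ℕ) (T : Type) [CommRing T] : Prop :=
  ∃ (_ : IsDomain T) (hT : IsLocalRing T), ringKrullDim T = d ∧
    (@maximalIdeal T _ hT).spanFinrank ≤ d + 1 ∧
    ∃ (S : Type) (_ : CommRing S) (_ : IsRegularLocalRing S) (π : S →+* T), Function.Surjective π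

/-- **o9h in predicate form**: an edim-candidate which is NOT a regular local ring is an abstract
hypersurface (`edim = dim` would make it regular, so `edim = dim + 1` and
`isRegularHypersurfaceQuotient_of_surjective` applies). [OURS] -/
theorem isRegularHypersurfaceQuotient_of_candidate {d : ℕ} {T : Type} [CommRing T]
    (h : IsEdimHypersurfaceCandidate d T) (hreg : ¬ IsRegularLocalRing T) :
    IsRegularHypersurfaceQuotient d T := by
  obtain ⟨_, hT, hdim, hedim, S, _, _, π, hπ⟩ := h
  haveI := hT
  haveI : IsNoetherianRing T := isNoetherianRing_of_surjective S T π hπ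
  -- `edim T ≥ dim T = d`, and `edim T = d` would make `T` regular
  have hge : (d : WithBot ℕ∞) ≤ (maximalIdeal T).spanFinrank := by
    rw [← hdim]; exact ringKrullDim_le_spanFinrank_maximalIdeal T
  have hd : d ≤ (maximalIdeal T).spanFinrank := by exact_mod_cast hge
  rcases Nat.lt_or_ge d (maximalIdeal T).spanFinrank with hlt | hle
  · have hedim' : (maximalIdeal T).spanFinrank = d + 1 := by omega
    exact isRegularHypersurfaceQuotient_of_surjective hdim hedim' _ S rfl π hπ
  · exfalso
    apply hreg
    refine IsRegularLocalRing.of_spanFinrank_maximalIdeal_le T ?_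
    rw [hdim]
    exact_mod_cast hle

/-- **`SaturationFourSurfaceResidual₃` (OURS · third cut, «edim ≥ 4»)** — o3's `SaturationFourSurface`
(binders VERBATIM) with the conclusion restricted to the stages `T_m` that are NOT regular, NOT presented
monic-hypersurface localisations over `k[x,y]`, and NOT edim-candidates for `d = 2` (local domain of
dimension `2`, embedding dimension `≤ 3`, quotient of a regular local ring): for presented normal surface
stages this is «embedding dimension `≥ 4`». NOT a statement of the manuscript. [this work] -/
@[conjecture]
def SaturationFourSurfaceResidual₃ : Prop :=
  ∀ p : ℕ, p.Prime → ∀ (k K : Type) [Field k] [CharP k p] [Field K] [Algebra k K] (O : ValuationSubring K) (A : Subalgebra k K), (∀ c : k, algebraMap k K c ∈ O) → A.FG → IsFractionRing ↥A K → A.toSubring ≤ O.toSubring → ringKrullDim ↥A ≤ 2 → let caAt : ℕ → Subalgebra k K → Set K := fun n A => {x : K | ∃ hx : x ∈ A, ∀ i : ℕ, n ≤ i → ∀ (M N : ModuleCat.{0} ↥A), Module.Finite ↥A M → Module.Finite ↥A N → ∀ e : CategoryTheory.Abelian.Ext.{0} M N i, (⟨x, hx⟩ : ↥A) • e = 0};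 let ca : Subalgebra k K → Set K := fun A => {x : K | ∃ hx : x ∈ A, ∃ n : ℕ, ∀ i : ℕ, n ≤ i → ∀ (M N : ModuleCat.{0} ↥A), Module.Finite ↥A M → Module.Finite ↥A N → ∀ e : CategoryTheory.Abelian.Ext.{0} M N i, (⟨x, hx⟩ : ↥A) • e = 0}; let loc : Subalgebra k K → Subalgebra k K := fun A => Algebra.adjoin k {y : K | ∃ a ∈ A, ∃ s ∈ A, s⁻¹ ∈ O ∧ y = a * s⁻¹}; let chart : Subalgebra k K → Subalgebra k K := fun A => Algebra.adjoin k ((A : Set K) ∪ {y : K | ∃ c ∈ ca A, ∃ x ∈ ca A, x ≠ 0 ∧ (∀ c' ∈ ca A, c' * x⁻¹ ∈ O) ∧ y = c * x⁻¹}); let nrm : Subalgebra k K → Subalgebra k K := fun B => Algebra.adjoin k {y : K | IsIntegral ↥B y}; let tower : Subalgebra k K → ℕ → Subalgebra k K := fun A m => @Nat.rec (fun _ => Subalgebra k K) (loc A) (fun _ B => loc (nrm (chart B))) m; ∀ m : ℕ, ¬ IsRegularLocalRing ↥(tower A m) → ¬ IsMonicHypersurfaceLocalization k 2 ↥(tower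 A m) → ¬ IsEdimHypersurfaceCandidate 2 ↥(tower A m) → ca (tower A m) ⊆ caAt 4 (tower A m)

/-- **The third cut**: `SaturationFourSurfaceResidual₃ → SaturationFourSurfaceResidual₂` (an
edim-candidate stage that is not regular is an abstract hypersurface, o9h). [OURS] -/
theorem saturationFourSurfaceResidual₂_of_residual₃ (h : SaturationFourSurfaceResidual₃) :
    SaturationFourSurfaceResidual₂ := by
  intro p hp k K _ _ _ _ O A hk hA hfr hAO hdim caAt ca loc chart nrm tower m hreg hmon hab x hx
  by_cases hcand : IsEdimHypersurfaceCandidate 2 ↥(NoZeno.Birth.tower O A m)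
  · exact absurd (isRegularHypersurfaceQuotient_of_candidate hcand hreg) hab
  · exact h p hp k K O A hk hA hfr hAO hdim m hreg hmon hcand hx

/-- `SaturationFourSurface` from the third residual. [OURS] -/
theorem saturationFourSurface_of_residual₃ (h : SaturationFourSurfaceResidual₃) :
    SaturationFourSurface :=
  saturationFourSurface_of_residual₂ (saturationFourSurfaceResidual₂_of_residual₃ h)

/-- The rung from the third residual and `L₄`. [OURS] -/
theorem persistenceSurface_of_residual₃_of_levelFour (hS : SaturationFourSurfaceResidual₃)
    (hL : LevelFourPersistenceSurface) :
    Summit.ResolutionOfSingularities.ResolutionOfSingularities.Theses.HomologicalConductor.PersistenceSurface :=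
  persistenceSurface_of_residual₂_of_levelFour (saturationFourSurfaceResidual₂_of_residual₃ hS) hL

end Summit.ResolutionOfSingularities.ResolutionOfSingularities.Theorems.HomologicalConductor.PersistenceSurfaceSaturationResidualThree

end
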